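import Literature.NumberTheory.DiophantineGeometry.TateAlgorithmTameTypesOddProofs
import Literature.NumberTheory.DiophantineGeometry.TateAlgorithmProofs
import Literature.NumberTheory.DiophantineGeometry.ConductorMultiplicativeProofs
import Literature.NumberTheory.DiophantineGeometry.ConductorAdditiveProofs
import Literature.NumberTheory.DiophantineGeometry.ConductorExponentLeTwoProofs
import Literature.NumberTheory.DiophantineGeometry.ConductorExponentLeFiveProofs
import Literature.NumberTheory.DiophantineGeometry.ConductorFactorizationProofs
import Literature.NumberTheory.DiophantineGeometry.ConductorRadicalProofs
import Literature.NumberTheory.EllipticCurves.MultiplicativeReductionJValuationProofs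
import Mathlib.Analysis.SpecialFunctions.Log.Basic
import Literature.NumberTheory.EllipticCurves.BSDConductor
import HarnessLib

/-!
# Crux `SingleTowerSzpiro` (stmt-ABC-22410), line `birth` — stub `stub_potentiallyGoodTowerOdd`

The POTENTIALLY-GOOD part of the single-tower bound at the odd places, unconditionally and inside the
budget with room: there is an absolute constant `C` (`= 8 log 3`) such that for every elliptic curve
`E/ℚ` and every finite place `v` of `ℤ` with `p_v ≠ 2` at which `j_E` is `v`-integral
(`v.valuation ℚ E.j ≤ 1`, i.e. potentially good reduction),

  `ord_v(Δ_min(E)) · log p_v ≤ 5 · log N_E + C`.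

Proof (Tate's algorithm, all inputs PROVED in the tree): at such a place the reduction is not
multiplicative (`|j|_v = exp(ord_v Δ_min) > 1` there,
`WeierstrassCurve.valuation_j_eq_exp_ordMinimalDiscriminant_of_hasMultiplicativeReductionAt`) and the Kodaira
type is not `Iₙ*`, `n ≥ 1` (`WeierstrassCurve.one_lt_valuation_j_of_kodairaSymbolAt_eq_Istar_succ`, `v ∤ 2`),
nor `Iₙ`, `n ≥ 1` (`WeierstrassCurve.kodairaSymbolAt_eq_I_iff_holds`); so `m_v ≤ 9` and Ogg's formula
(the tree's DEFINITION `f_v = ord_v(Δ_min) + 1 − m_v`, with `m_v ≤ ord_v(Δ_min) + 1`,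
`WeierstrassCurve.numComponentsAt_le_holds`) gives `ord_v(Δ_min) ≤ f_v + 8`. If `p_v ≥ 5` then
`f_v ≤ 2` (`conductorExponent_le_two_of_five_le_natGenerator_holds`), `f_v ≠ 1`
(`conductorExponent_eq_one_iff_holds`) and `f_v ≠ 0` at a bad place, so `f_v = 2`, `p_v² ∣ N_E`
(`factorization_conductorNorm_holds`) and the tower is `≤ 10 log p_v ≤ 5 log N_E`; if `p_v = 3` then
`f_v ≤ 5` (`conductorExponent_le_five_of_natGenerator_eq_three_holds`) and the tower is
`≤ (f_v + 8) log 3 ≤ log N_E + 8 log 3`. (Silverman ATAEC IV.9.4, Table 4.1, IV.10.4, IV.11.1.)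

The place `p_v = 2` is excluded: there `Iₙ*` with `v(j) ≥ 0` occurs, and the boundedness of
`ord_2(Δ_min)` for potentially good reduction is the separate registered stub `stub_potentiallyGoodOrdTwo`
(Kraus 1990 / Papadopoulos 1993). Places with `v(j_E) < 0` are the crux proper
(`stub_multiplicativeTower`) and its twist transfer (`stub_twistTransfer`).

HONESTY: a classical bookkeeping piece of the line, NOT progress on the crux `SingleTowerSzpiro`; abc is not
proved by any of this; typed ≠ proved. No `sorry`, no new axiom, no `def`.
-/

noncomputable section

-- `Summit.<Summit>.<Problem>` is the mandated summit-side namespace (CONVENTIONS §2); for the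
-- single-conjunct summit `ABC` the two coincide, so the duplicate `ABC.ABC` is deliberate.
set_option linter.dupNamespace false

namespace Summit.ABC.ABC.Theorems.SingleTowerSzpiroLine

open IsDedekindDomain Literature.NumberTheory.DiophantineGeometry

/-- At a place `v ∤ 2` where `j_E` is integral, the number of components of the special fibre is at
most `9`: the Kodaira type is neither `Iₙ` (`n ≥ 1`, multiplicative: `|j|_v > 1`) nor `Iₙ*` (`n ≥ 1`:
`|j|_v > 1` at `v ∤ 2`). Silverman ATAEC Table 4.1. [folklore] -/
theorem numComponentsAt_le_nine_of_valuation_j_le_one (W : WeierstrassCurve ℚ) [W.IsElliptic]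
    (v : HeightOneSpectrum ℤ) (hp2 : Rat.HeightOneSpectrum.natGenerator v ≠ 2)
    (hj : v.valuation ℚ W.j ≤ 1) : W.numComponentsAt v ≤ 9 := by
  have hnm : ¬ W.HasMultiplicativeReductionAt v := by
    intro hm
    have h := WeierstrassCurve.valuation_j_eq_exp_ordMinimalDiscriminant_of_hasMultiplicativeReductionAt
      v W hm
    rw [h, ← WithZero.exp_zero, WithZero.exp_le_exp] at hj
    have hne : W.ordMinimalDiscriminant v ≠ 0 :=
      ((WeierstrassCurve.conductorExponent_eq_one_iff_holds v W).mpr hm ▸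
        (WeierstrassCurve.conductorExponent_ne_zero_iff_ordMinimalDiscriminant_ne_zero v W)).mp
        one_ne_zero
    omega
  have h2 : ringChar (ℤ ⧸ v.asIdeal) ≠ 2 := by
    rw [Literature.NumberTheory.EllipticCurves.Rat.ringChar_int_quotient_asIdeal]; exact hp2
  unfold WeierstrassCurve.numComponentsAt
  rcases hk : W.kodairaSymbolAt v with n | _ | _ | _ | n | _ | _ | _
  · rcases n with _ | n
    · simp [KodairaSymbol.numComponents]
    · exact absurd ((WeierstrassCurve.kodairaSymbolAt_eq_I_iff_holds v W (Nat.succ_ne_zero n)).mp hk).1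
        hnm
  · simp [KodairaSymbol.numComponents]
  · simp [KodairaSymbol.numComponents]
  · simp [KodairaSymbol.numComponents]
  · rcases n with _ | n
    · simp [KodairaSymbol.numComponents]
    · exact absurd hj
        (not_le.mpr (WeierstrassCurve.one_lt_valuation_j_of_kodairaSymbolAt_eq_Istar_succ v W h2 hk))
  · simp [KodairaSymbol.numComponents]
  · simp [KodairaSymbol.numComponents]
  · simp [KodairaSymbol.numComponents]

/-- **Stub `stub_potentiallyGoodTowerOdd` of line `birth` (crux stmt-ABC-22410).** At every finite place
`v ∤ 2` where `j_E` is integral, `ord_v(Δ_min(E)) · log p_v ≤ 5 · log N_E + 8 log 3`. [folklore] -/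
theorem stub_potentiallyGoodTowerOdd : ∃ C : ℝ, ∀ (W : WeierstrassCurve ℚ) [W.IsElliptic] (v : HeightOneSpectrum ℤ), Rat.HeightOneSpectrum.natGenerator v ≠ 2 → v.valuation ℚ W.j ≤ 1 → (W.ordMinimalDiscriminant v : ℝ) * Real.log (Rat.HeightOneSpectrum.natGenerator v : ℝ) ≤ 5 * Real.log (W.conductorNorm ℤ : ℝ) + C := by
  refine ⟨8 * Real.log 3, fun W _ v hp2 hj => ?_⟩
  have hpp : (Rat.HeightOneSpectrum.natGenerator v).Prime := Rat.HeightOneSpectrum.prime_natGenerator v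
  have hN : 0 < W.conductorNorm ℤ := WeierstrassCurve.conductorNorm_pos_holds W
  have hN1 : (1 : ℝ) ≤ (W.conductorNorm ℤ : ℝ) := by exact_mod_cast hN
  have hlogN : 0 ≤ Real.log (W.conductorNorm ℤ : ℝ) := Real.log_nonneg hN1
  have hlog3 : 0 ≤ Real.log 3 := Real.log_nonneg (by norm_num)
  have hp1 : (1 : ℝ) ≤ (Rat.HeightOneSpectrum.natGenerator v : ℝ) := by exact_mod_cast hpp.one_lt.le
  have hlogp : 0 ≤ Real.log (Rat.HeightOneSpectrum.natGenerator v : ℝ) := Real.log_nonneg hp1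
  by_cases he : W.ordMinimalDiscriminant v = 0
  · rw [he, Nat.cast_zero, zero_mul]
    positivity
  -- a bad place: `f_v ≠ 0`, `p^f ∣ N`
  have hf0 : W.conductorExponent v ≠ 0 :=
    (WeierstrassCurve.conductorExponent_ne_zero_iff_ordMinimalDiscriminant_ne_zero v W).mpr he
  have hpf : Rat.HeightOneSpectrum.natGenerator v ^ W.conductorExponent v ≤ W.conductorNorm ℤ := by
    rw [← WeierstrassCurve.factorization_conductorNorm_holds W v]
    exact Nat.ordProj_le _ hN.ne'
  have hflog : (W.conductorExponent v : ℝ) * Real.log (Rat.HeightOneSpectrum.natGenerator v : ℝ) ≤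
      Real.log (W.conductorNorm ℤ : ℝ) := by
    rw [← Real.log_pow]
    exact Real.log_le_log (by positivity) (by exact_mod_cast hpf)
  -- Ogg: `ord = f + m - 1 ≤ f + 8`
  have hm9 := numComponentsAt_le_nine_of_valuation_j_le_one W v hp2 hj
  have hmle : W.numComponentsAt v ≤ W.ordMinimalDiscriminant v + 1 :=
    WeierstrassCurve.numComponentsAt_le_holds v W
  have hfdef : W.conductorExponent v = W.ordMinimalDiscriminant v + 1 - W.numComponentsAt v := rfl
  have hele : W.ordMinimalDiscriminant v ≤ W.conductorExponent v + 8 := by omega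
  -- not multiplicative, so `f_v ≠ 1`
  have hf1 : W.conductorExponent v ≠ 1 := by
    intro h1
    have hm := (WeierstrassCurve.conductorExponent_eq_one_iff_holds v W).mp h1
    have h := WeierstrassCurve.valuation_j_eq_exp_ordMinimalDiscriminant_of_hasMultiplicativeReductionAt
      v W hm
    rw [h, ← WithZero.exp_zero, WithZero.exp_le_exp] at hj
    omega
  -- `p = 3` or `p ≥ 5`
  have hp35 : Rat.HeightOneSpectrum.natGenerator v = 3 ∨ 5 ≤ Rat.HeightOneSpectrum.natGenerator v := by
    have h2le := hpp.two_le
    have h4 : Rat.HeightOneSpectrum.natGenerator v ≠ 4 := by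
      intro h4; rw [h4] at hpp; exact absurd hpp (by decide)
    omega
  rcases hp35 with h3 | h5
  · -- `p = 3`: `f ≤ 5`, tower `≤ (f + 8) log 3 ≤ log N + 8 log 3`
    have hf5 : W.conductorExponent v ≤ 5 :=
      WeierstrassCurve.conductorExponent_le_five_of_natGenerator_eq_three_holds W v h3
    rw [h3] at hflog ⊢
    have hele' : (W.ordMinimalDiscriminant v : ℝ) ≤ (W.conductorExponent v : ℝ) + 8 := by
      exact_mod_cast hele
    push_cast at hflog ⊢
    nlinarith [hele', hflog, hlog3, hlogN]
  · -- `p ≥ 5`: `f = 2`, `p² ∣ N`, tower `≤ 10 log p ≤ 5 log N`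
    have hf2 : W.conductorExponent v ≤ 2 :=
      WeierstrassCurve.conductorExponent_le_two_of_five_le_natGenerator_holds W v h5
    have hf : W.conductorExponent v = 2 := by omega
    rw [hf] at hflog
    have hele' : (W.ordMinimalDiscriminant v : ℝ) ≤ 10 := by
      have : W.ordMinimalDiscriminant v ≤ 10 := by omega
      exact_mod_cast this
    push_cast at hflog
    nlinarith [hele', hflog, hlogp, hlog3, hlogN]

end Summit.ABC.ABC.Theorems.SingleTowerSzpiroLine

end
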